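import Mathlib.Analysis.SpecialFunctions.SmoothTransition
import Mathlib.Analysis.InnerProductSpace.Calculus
import Mathlib.Analysis.InnerProductSpace.PiL2
import Mathlib.Analysis.SpecialFunctions.Trigonometric.Deriv
import HarnessLib

/-!
# Rotations, Dehn twist powers and cap rotations of the plane (annulus twist, layer 1)

Auxiliary file (layer 1) of helper `helper_sliceGluing_annulusTwist` (a diffeomorphism of the
annulus `5/4 ≤ ‖z‖ ≤ 7/4` fixed near its boundary is isotopic, rel the disc `‖z‖ ≤ 9/8` and
rel `‖z‖ ≥ 15/8`, to a power of the Dehn twist), line `Sketch`, crux `SblfDescent.RungOne`.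

(Crux item stmt-SmoothPoincare4-18531; skeleton `Cruxes/RungOne/Lines/Sketch.lean`.)

Elementary plane geometry used throughout the proof: the rotation `rotL β` of
`ℝ² = EuclideanSpace ℝ (Fin 2)` as a continuous linear map (group law, norm preservation,
`2π`-periodicity, joint smoothness in `(β, z)`), the radial cut-off
`τ z = smoothTransition (2 (‖z‖ - 5/4))` (`0` on `‖z‖ ≤ 5/4`, `1` on `‖z‖ ≥ 7/4`, smooth), the
**Dehn twist of angle `a`**, `twist a z = R(a τ(z)) z` (the identity on the inner disc, the
rotation `R(a)` outside `7/4`; for `a = 2πk` it is the `k`-th power of the Dehn twist of the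
annulus, the identity off the annulus), and the **cap rotation** `capRot a z = R(a (1 - τ z)) z`
(the rotation `R(a)` on the inner disc, the identity outside `7/4`): a compactly supported
diffeomorphism of the plane realising the rotation near the origin, with
`capRot (2πk) = twist (-2πk)` (Farb–Margalit, *A primer on mapping class groups* (2012), §3.1.1:
the twist map `T(θ, t) = (θ + 2πt, t)`).

## References

* B. Farb, D. Margalit, *A primer on mapping class groups*, PMS 49 (2012), §3.1.1.
  [FarbMargalit2012]
-/

set_option linter.dupNamespace false

noncomputable section

open scoped ContDiff Topology Real
open Set Function Metric

namespace Summit.SmoothPoincare4.SmoothPoincare4.Cruxes.RungOne.Sketch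

namespace AnnulusTwist

/-! ### Rotations of the plane -/

/-- The rotation of `ℝ²` by the angle `β`, as a linear map. [folklore] -/
def rotLin (β : ℝ) : EuclideanSpace ℝ (Fin 2) →ₗ[ℝ] EuclideanSpace ℝ (Fin 2) where
  toFun z := !₂[Real.cos β * z 0 - Real.sin β * z 1, Real.sin β * z 0 + Real.cos β * z 1]
  map_add' z w := by
    ext i; fin_cases i <;> simp <;> ring
  map_smul' r z := by
    ext i; fin_cases i <;> simp <;> ring

/-- **The rotation `R(β)` of `ℝ²` by the angle `β`**, as a continuous linear map. [folklore] -/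
def rotL (β : ℝ) : EuclideanSpace ℝ (Fin 2) →L[ℝ] EuclideanSpace ℝ (Fin 2) :=
  LinearMap.toContinuousLinearMap (rotLin β)

/-- First coordinate of a rotated vector. [folklore] -/
@[simp] theorem rotL_apply_zero (β : ℝ) (z : EuclideanSpace ℝ (Fin 2)) :
    (rotL β z) 0 = Real.cos β * z 0 - Real.sin β * z 1 := by
  simp [rotL, rotLin]

/-- Second coordinate of a rotated vector. [folklore] -/
@[simp] theorem rotL_apply_one (β : ℝ) (z : EuclideanSpace ℝ (Fin 2)) :
    (rotL β z) 1 = Real.sin β * z 0 + Real.cos β * z 1 := by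
  simp [rotL, rotLin]

/-- Two vectors of `ℝ²` with the same coordinates are equal. [folklore] -/
theorem ext2 {z w : EuclideanSpace ℝ (Fin 2)} (h0 : z 0 = w 0) (h1 : z 1 = w 1) : z = w := by
  ext i; fin_cases i
  · exact h0
  · exact h1

/-- `R(0) = id`. [folklore] -/
@[simp] theorem rotL_zero_apply (z : EuclideanSpace ℝ (Fin 2)) : rotL 0 z = z :=
  ext2 (by simp) (by simp)

/-- The group law `R(a) R(b) = R(a + b)`. [folklore] -/
theorem rotL_rotL (a b : ℝ) (z : EuclideanSpace ℝ (Fin 2)) : rotL a (rotL b z) = rotL (a + b) z := by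
  refine ext2 ?_ ?_
  · simp only [rotL_apply_zero, rotL_apply_one, Real.cos_add, Real.sin_add]; ring
  · simp only [rotL_apply_zero, rotL_apply_one, Real.cos_add, Real.sin_add]; ring

/-- `R(-a) R(a) = id`. [folklore] -/
@[simp] theorem rotL_neg_rotL (a : ℝ) (z : EuclideanSpace ℝ (Fin 2)) : rotL (-a) (rotL a z) = z := by
  rw [rotL_rotL, neg_add_cancel, rotL_zero_apply]

/-- `R(a) R(-a) = id`. [folklore] -/
@[simp] theorem rotL_rotL_neg (a : ℝ) (z : EuclideanSpace ℝ (Fin 2)) : rotL a (rotL (-a) z) = z := by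
  rw [rotL_rotL, add_neg_cancel, rotL_zero_apply]

/-- Rotations preserve the norm. [folklore] -/
@[simp] theorem norm_rotL (β : ℝ) (z : EuclideanSpace ℝ (Fin 2)) : ‖rotL β z‖ = ‖z‖ := by
  have h1 : ‖rotL β z‖ ^ 2 = ‖z‖ ^ 2 := by
    rw [EuclideanSpace.real_norm_sq_eq, EuclideanSpace.real_norm_sq_eq, Fin.sum_univ_two,
      Fin.sum_univ_two, rotL_apply_zero, rotL_apply_one]
    have := Real.sin_sq_add_cos_sq β
    nlinarith [this]
  nlinarith [norm_nonneg (rotL β z), norm_nonneg z, h1]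

/-- `R(2πk) = id` for an integer `k`. [folklore] -/
theorem rotL_two_pi_mul_int (k : ℤ) (z : EuclideanSpace ℝ (Fin 2)) : rotL (2 * π * k) z = z := by
  have hc : Real.cos (2 * π * k) = 1 := by
    rw [show 2 * π * k = (k : ℝ) * (2 * π) by ring, Real.cos_int_mul_two_pi]
  have hs : Real.sin (2 * π * k) = 0 := by
    rw [show 2 * π * k = ((2 * k : ℤ) : ℝ) * π by push_cast; ring, Real.sin_int_mul_pi]
  refine ext2 ?_ ?_
  · rw [rotL_apply_zero, hc, hs]; ring
  · rw [rotL_apply_one, hc, hs]; ring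

/-- `R(a + 2πk) = R(a)`. [folklore] -/
theorem rotL_add_two_pi_mul_int (a : ℝ) (k : ℤ) (z : EuclideanSpace ℝ (Fin 2)) :
    rotL (a + 2 * π * k) z = rotL a z := by
  rw [← rotL_rotL, rotL_two_pi_mul_int]

/-- **Joint smoothness of `(β, z) ↦ R(β) z`.** [folklore] -/
theorem contDiff_rotL : ContDiff ℝ ∞ fun p : ℝ × EuclideanSpace ℝ (Fin 2) => rotL p.1 p.2 := by
  have h0 : ContDiff ℝ ∞ fun p : ℝ × EuclideanSpace ℝ (Fin 2) => p.2 0 :=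
    (contDiff_euclidean.1 contDiff_snd 0)
  have h1 : ContDiff ℝ ∞ fun p : ℝ × EuclideanSpace ℝ (Fin 2) => p.2 1 :=
    (contDiff_euclidean.1 contDiff_snd 1)
  have hc : ContDiff ℝ ∞ fun p : ℝ × EuclideanSpace ℝ (Fin 2) => Real.cos p.1 :=
    Real.contDiff_cos.comp contDiff_fst
  have hs : ContDiff ℝ ∞ fun p : ℝ × EuclideanSpace ℝ (Fin 2) => Real.sin p.1 :=
    Real.contDiff_sin.comp contDiff_fst
  have e0 : (fun p : ℝ × EuclideanSpace ℝ (Fin 2) => (rotL p.1 p.2) 0) =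
      fun p => Real.cos p.1 * p.2 0 - Real.sin p.1 * p.2 1 := by
    funext p; exact rotL_apply_zero _ _
  have e1 : (fun p : ℝ × EuclideanSpace ℝ (Fin 2) => (rotL p.1 p.2) 1) =
      fun p => Real.sin p.1 * p.2 0 + Real.cos p.1 * p.2 1 := by
    funext p; exact rotL_apply_one _ _
  rw [contDiff_euclidean, Fin.forall_fin_two, e0, e1]
  exact ⟨(hc.mul h0).sub (hs.mul h1), (hs.mul h0).add (hc.mul h1)⟩

/-- Smoothness of `x ↦ R(g x) (h x)` for smooth `g`, `h`. [folklore] -/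
theorem ContDiff.rotL {X : Type*} [NormedAddCommGroup X] [NormedSpace ℝ X] {g : X → ℝ}
    {h : X → EuclideanSpace ℝ (Fin 2)} (hg : ContDiff ℝ ∞ g) (hh : ContDiff ℝ ∞ h) :
    ContDiff ℝ ∞ fun x => rotL (g x) (h x) :=
  contDiff_rotL.comp₂ hg hh

/-! ### The radial cut-off -/

/-- **The radial cut-off** `τ z = smoothTransition (2 (‖z‖ - 5/4))`: `0` on the disc `‖z‖ ≤ 5/4`,
`1` outside `7/4`. [folklore] -/
def rcut (z : EuclideanSpace ℝ (Fin 2)) : ℝ := Real.smoothTransition (2 * (‖z‖ - 5 / 4))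

/-- `τ = 0` on the inner disc. [folklore] -/
theorem rcut_of_le {z : EuclideanSpace ℝ (Fin 2)} (hz : ‖z‖ ≤ 5 / 4) : rcut z = 0 :=
  Real.smoothTransition.zero_of_nonpos (by linarith)

/-- `τ = 1` outside `7/4`. [folklore] -/
theorem rcut_of_ge {z : EuclideanSpace ℝ (Fin 2)} (hz : 7 / 4 ≤ ‖z‖) : rcut z = 1 :=
  Real.smoothTransition.one_of_one_le (by linarith)

/-- `τ` is rotation invariant. [folklore] -/
@[simp] theorem rcut_rotL (β : ℝ) (z : EuclideanSpace ℝ (Fin 2)) : rcut (rotL β z) = rcut z := by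
  rw [rcut, rcut, norm_rotL]

/-- **The radial cut-off is smooth** (it is locally constant near the origin, where the norm is
not differentiable). [folklore] -/
theorem contDiff_rcut : ContDiff ℝ ∞ rcut := by
  refine contDiff_iff_contDiffAt.2 fun z => ?_
  by_cases hz : ‖z‖ < 5 / 4
  · have hev : rcut =ᶠ[𝓝 z] fun _ => 0 := by
      filter_upwards [Metric.isOpen_ball.mem_nhds (mem_ball_zero_iff.2 hz)] with w hw
      exact rcut_of_le (mem_ball_zero_iff.1 hw).le
    exact (contDiffAt_const.congr_of_eventuallyEq hev)
  · have hz0 : z ≠ 0 := by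
      rintro rfl; exact hz (by norm_num)
    exact Real.smoothTransition.contDiff.contDiffAt.comp z
      (contDiffAt_const.mul ((contDiffAt_norm ℝ hz0).sub contDiffAt_const))

/-! ### Dehn twists and cap rotations -/

/-- **The Dehn twist of total angle `a`**: `twist a z = R(a τ(z)) z`, the identity on the disc
`‖z‖ ≤ 5/4` and the rotation `R(a)` outside `7/4`; for `a = 2πk` this is the `k`-th power of the
Dehn twist about the core of the annulus `5/4 ≤ ‖z‖ ≤ 7/4`. [cite: FarbMargalit2012, §3.1.1] -/
def twist (a : ℝ) (z : EuclideanSpace ℝ (Fin 2)) : EuclideanSpace ℝ (Fin 2) := rotL (a * rcut z) z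

/-- **The cap rotation of angle `a`**: `capRot a z = R(a (1 - τ z)) z`, the rotation `R(a)` on
the disc `‖z‖ ≤ 5/4` and the identity outside `7/4`. [folklore] -/
def capRot (a : ℝ) (z : EuclideanSpace ℝ (Fin 2)) : EuclideanSpace ℝ (Fin 2) :=
  rotL (a * (1 - rcut z)) z

/-- The twist preserves the norm. [folklore] -/
@[simp] theorem norm_twist (a : ℝ) (z : EuclideanSpace ℝ (Fin 2)) : ‖twist a z‖ = ‖z‖ := norm_rotL _ _

/-- The cap rotation preserves the norm. [folklore] -/
@[simp] theorem norm_capRot (a : ℝ) (z : EuclideanSpace ℝ (Fin 2)) : ‖capRot a z‖ = ‖z‖ := norm_rotL _ _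

/-- The twist is the identity on the inner disc. [folklore] -/
theorem twist_of_le (a : ℝ) {z : EuclideanSpace ℝ (Fin 2)} (hz : ‖z‖ ≤ 5 / 4) : twist a z = z := by
  rw [twist, rcut_of_le hz, mul_zero, rotL_zero_apply]

/-- The twist is the rotation `R(a)` outside `7/4`. [folklore] -/
theorem twist_of_ge (a : ℝ) {z : EuclideanSpace ℝ (Fin 2)} (hz : 7 / 4 ≤ ‖z‖) : twist a z = rotL a z := by
  rw [twist, rcut_of_ge hz, mul_one]

/-- The cap rotation is the rotation `R(a)` on the inner disc. [folklore] -/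
theorem capRot_of_le (a : ℝ) {z : EuclideanSpace ℝ (Fin 2)} (hz : ‖z‖ ≤ 5 / 4) : capRot a z = rotL a z := by
  rw [capRot, rcut_of_le hz, sub_zero, mul_one]

/-- The cap rotation is the identity outside `7/4`. [folklore] -/
theorem capRot_of_ge (a : ℝ) {z : EuclideanSpace ℝ (Fin 2)} (hz : 7 / 4 ≤ ‖z‖) : capRot a z = z := by
  rw [capRot, rcut_of_ge hz, sub_self, mul_zero, rotL_zero_apply]

/-- `twist 0 = id`. [folklore] -/
@[simp] theorem twist_zero (z : EuclideanSpace ℝ (Fin 2)) : twist 0 z = z := by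
  rw [twist, zero_mul, rotL_zero_apply]

/-- `capRot 0 = id`. [folklore] -/
@[simp] theorem capRot_zero (z : EuclideanSpace ℝ (Fin 2)) : capRot 0 z = z := by
  rw [capRot, zero_mul, rotL_zero_apply]

/-- `twist (-a) ∘ twist a = id`. [folklore] -/
@[simp] theorem twist_neg_twist (a : ℝ) (z : EuclideanSpace ℝ (Fin 2)) : twist (-a) (twist a z) = z := by
  unfold twist
  rw [rcut_rotL, neg_mul, rotL_neg_rotL]

/-- `twist a ∘ twist (-a) = id`. [folklore] -/
@[simp] theorem twist_twist_neg (a : ℝ) (z : EuclideanSpace ℝ (Fin 2)) : twist a (twist (-a) z) = z := by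
  simpa using twist_neg_twist (-a) z

/-- `capRot (-a) ∘ capRot a = id`. [folklore] -/
@[simp] theorem capRot_neg_capRot (a : ℝ) (z : EuclideanSpace ℝ (Fin 2)) : capRot (-a) (capRot a z) = z := by
  unfold capRot
  rw [rcut_rotL, neg_mul, rotL_neg_rotL]

/-- `capRot a ∘ capRot (-a) = id`. [folklore] -/
@[simp] theorem capRot_capRot_neg (a : ℝ) (z : EuclideanSpace ℝ (Fin 2)) : capRot a (capRot (-a) z) = z := by
  simpa using capRot_neg_capRot (-a) z

/-- **`capRot (2πk) = twist (-2πk)`**: a full cap rotation by `k` turns is the `(-k)`-th Dehn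
twist power. [cite: FarbMargalit2012, §3.1.1] -/
theorem capRot_two_pi_mul_int (k : ℤ) (z : EuclideanSpace ℝ (Fin 2)) :
    capRot (2 * π * k) z = twist (-(2 * π * k)) z := by
  rw [capRot, twist, mul_sub, mul_one, sub_eq_neg_add, ← neg_mul, rotL_add_two_pi_mul_int]

/-- The twist composed with its cap rotation is a rigid rotation: `twist a (capRot a z) = R(a) z`.
[folklore] -/
theorem twist_capRot (a : ℝ) (z : EuclideanSpace ℝ (Fin 2)) : twist a (capRot a z) = rotL a z := by
  unfold twist capRot
  rw [rcut_rotL, rotL_rotL]; congr 1; ring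

/-- **Joint smoothness of `(a, z) ↦ twist a z`.** [folklore] -/
theorem contDiff_twist : ContDiff ℝ ∞ fun p : ℝ × EuclideanSpace ℝ (Fin 2) => twist p.1 p.2 :=
  ContDiff.rotL (contDiff_fst.mul (contDiff_rcut.comp contDiff_snd)) contDiff_snd

/-- **Joint smoothness of `(a, z) ↦ capRot a z`.** [folklore] -/
theorem contDiff_capRot : ContDiff ℝ ∞ fun p : ℝ × EuclideanSpace ℝ (Fin 2) => capRot p.1 p.2 :=
  ContDiff.rotL (contDiff_fst.mul (contDiff_const.sub (contDiff_rcut.comp contDiff_snd))) contDiff_snd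

/-- Smoothness of `x ↦ twist (g x) (h x)`. [folklore] -/
theorem ContDiff.twist {X : Type*} [NormedAddCommGroup X] [NormedSpace ℝ X] {g : X → ℝ}
    {h : X → EuclideanSpace ℝ (Fin 2)} (hg : ContDiff ℝ ∞ g) (hh : ContDiff ℝ ∞ h) :
    ContDiff ℝ ∞ fun x => twist (g x) (h x) :=
  contDiff_twist.comp₂ hg hh

/-- Smoothness of `x ↦ capRot (g x) (h x)`. [folklore] -/
theorem ContDiff.capRot {X : Type*} [NormedAddCommGroup X] [NormedSpace ℝ X] {g : X → ℝ}
    {h : X → EuclideanSpace ℝ (Fin 2)} (hg : ContDiff ℝ ∞ g) (hh : ContDiff ℝ ∞ h) :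
    ContDiff ℝ ∞ fun x => capRot (g x) (h x) :=
  contDiff_capRot.comp₂ hg hh

/-- Near the origin the cap rotation is the linear rotation. [folklore] -/
theorem capRot_eventuallyEq (a : ℝ) : capRot a =ᶠ[𝓝 (0 : EuclideanSpace ℝ (Fin 2))] rotL a := by
  filter_upwards [Metric.closedBall_mem_nhds (0 : EuclideanSpace ℝ (Fin 2)) (by norm_num : (0 : ℝ) < 5 / 4)]
    with z hz
  exact capRot_of_le a (by simpa using hz)

/-- **The differential of the cap rotation at the origin is the rotation `R(a)`.** [folklore] -/
theorem fderiv_capRot_zero (a : ℝ) : fderiv ℝ (capRot a) 0 = rotL a := by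
  rw [(capRot_eventuallyEq a).fderiv_eq]
  exact (rotL a).fderiv

/-- The cap rotation fixes the origin. [folklore] -/
@[simp] theorem capRot_apply_zero (a : ℝ) : capRot a 0 = 0 := by
  rw [capRot_of_le a (by rw [norm_zero]; norm_num), map_zero]

/-- The coordinate vector `e₀ = (1, 0)`. [folklore] -/
theorem rotL_single_zero (β : ℝ) :
    rotL β (EuclideanSpace.single 0 1) = !₂[Real.cos β, Real.sin β] := by
  refine ext2 ?_ ?_ <;> simp

/-- The coordinates of the twist, in the raw form of the statement of
`helper_sliceGluing_annulusTwist`. [folklore] -/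
theorem twist_apply_coord (a : ℝ) (z : EuclideanSpace ℝ (Fin 2)) :
    (twist a z) 0 = Real.cos (a * Real.smoothTransition (2 * (‖z‖ - 5 / 4))) * z 0 -
        Real.sin (a * Real.smoothTransition (2 * (‖z‖ - 5 / 4))) * z 1 ∧
      (twist a z) 1 = Real.sin (a * Real.smoothTransition (2 * (‖z‖ - 5 / 4))) * z 0 +
        Real.cos (a * Real.smoothTransition (2 * (‖z‖ - 5 / 4))) * z 1 :=
  ⟨rotL_apply_zero _ _, rotL_apply_one _ _⟩

/-- **Registered sub-helper `helper_ann_twistMaps`** (layer 1 of `helper_sliceGluing_annulusTwist`):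
the `k`-th Dehn twist power `z ↦ R(2πk · smoothTransition (2 (‖z‖ - 5/4))) z` of the statement is
the identity on the inner disc `‖z‖ ≤ 5/4`. [cite: FarbMargalit2012, §3.1.1] -/
theorem helper_ann_twistMaps : ∀ (k : ℤ) (z : EuclideanSpace ℝ (Fin 2)), ‖z‖ ≤ 5 / 4 → Real.cos (2 * Real.pi * k * Real.smoothTransition (2 * (‖z‖ - 5 / 4))) * z 0 - Real.sin (2 * Real.pi * k * Real.smoothTransition (2 * (‖z‖ - 5 / 4))) * z 1 = z 0 ∧ Real.sin (2 * Real.pi * k * Real.smoothTransition (2 * (‖z‖ - 5 / 4))) * z 0 + Real.cos (2 * Real.pi * k * Real.smoothTransition (2 * (‖z‖ - 5 / 4))) * z 1 = z 1 := by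
  intro k z hz
  obtain ⟨h0, h1⟩ := twist_apply_coord (2 * π * k) z
  have h := twist_of_le (2 * π * k) hz
  exact ⟨by rw [← h0, h], by rw [← h1, h]⟩

end AnnulusTwist

end Summit.SmoothPoincare4.SmoothPoincare4.Cruxes.RungOne.Sketch

end
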